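import Literature.MathematicalPhysics.QuantumFieldTheory.Balaban1983to89.B7Prop3GeneralLinearRec
import Literature.MathematicalPhysics.QuantumFieldTheory.Balaban1983to89.B7Prop3GeneralTild

/-!
# `Balaban1983to89.B7Prop3GeneralTildRec` — [Balaban1985Averaging] PROPOSITION 3 AT A GENERAL BACKGROUND, THE LINEAR PART, file 2 — (113)–(120) pp. 34–35 — FOR THE RECORD's AVERAGING
# STRUCTURE ([Balaban1987RG1] (0.3)–(0.4)): the derivative of `Ṽ₁(c)` along `V₁ = e^{tA}` — HERE THE (0.4) LOOPS ENTER: every loop variable `W_i = V(Γ ∪ [x,x′] ∪ (−Γ′) ∪ (−c))`,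
# `i = (x, π, π′)`, differentiated, `(D log)` at each background loop, averaged with the weights `|IdxZ|⁻¹` — print's `(Q′(V₀)A)_c` for the record (`QprimeCovZ`), and the linear part
# «L(Q(V₀)A)_c» IN CLOSED FORM (120) with its additivity ∕ homogeneity in `A`

statement-level skeleton of published theorems with citation tags; proofs where landed; nothing here is a claim about the Yang–Mills mass gap

CITATION HEADER (lean-in-tree rule).  Cell `pub-ymgap`, seat `pub-ymgap-dag-n05-e` g35 (N05-REC LEAD PEN); item R1 ([3] layer) — file 2 of the Prop. 3 general-background chain for the record.
`--kind proof --supports stmt-QuantumFields-20541` (K0⁷; count-neutral; no definition).  Sources READ: [3] pp. 34–36 (`paper:balaban1985-cmp98-averaging`), [Balaban1987RG1] (0.4) p. 253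
(`paper:balaban1987-cmp109-rg-i-small-field`: «The proofs are in most cases unchanged; in others only minor and obvious modifications are needed», p. 254), through the engine module
`B7Prop3GeneralTild` §2–§4, re-run over the record objects (TOKEN RULE (T1): `Wcx … (boxVec r) ↦ WZ … i` with `i : IdxZ d L`, block weights `L^{−d} ↦ |IdxZ|⁻¹`, `Xavg ↦ XZ`, `bavg ↦ bavgZ`,
`Aloop ∕ DXavg ∕ QprimeCov ↦ AloopZ ∕ DXavgZ ∕ QprimeCovZ` of `B7SectEFLinearisationRec`; the loop of `W_i` is NODE 00's `loopWord`, `WZ_def`).  The Fréchet calculus of `exp`∕`log`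
(`B12AverageCorridor267.Dmlog ∕ Dexp ∕ PhiY`), the rotated functional `tsum` and `hasDerivAt_hol_expCfg_mul` (`B7Prop3GeneralRotated`) are REUSED BY NAME.  The flat sanity `loops_flat` is not twinned.
WHAT IS PROVED (sorry-free): §2 ★`hasDerivAt_WZ_expCfg` ((114) linearised for every (0.4) loop), `hasDerivAt_mlog_WZ_expCfg` ((116) to first order), ★`hasDerivAt_XZ_expCfg` (the exponent of (0.4) along the ray);
§3 `val_tildZ_expCfg` ((113) for the record), ★★`hasDerivAt_tildZ_expCfg` (THE DERIVATIVE OF `Ṽ₁(c)` = `QprimeCovZ`); §4 ★`hasDerivAt_QcovZ`, ★`linQcovZ_eq` ((120) ⇒ (122) in closed form), `FhatCovZ_add∕_smul`,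
`QprimeCovZ_add`, `DXavgZ_smul`, `QprimeCovZ_smul`, ★`linQcovZ_add`, `linQcovZ_smul` (the linear part IS linear), all under the small-loop guard `‖W_i(V₀) − 1‖ < 1` on the block.
HONEST SCOPE.  First-order calculus identities for OUR typed record objects; no estimate yet ((124)–(126) are the sequel's); `HThm4Rec` UNDISCHARGED; N05 ∕ N07 NOT discharged; counts unmoved
(typed 28∕28 · discharged 7∕28); one finite 𝕋⁴ programme at fixed ε — nothing continuum ∕ ℝ⁴ ∕ OS ∕ mass gap ∕ Clay.  No `def`, no `instance`, no `notation`, no `sorry`.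
-/

set_option autoImplicit false

noncomputable section

open scoped BigOperators
open NormedSpace Finset

namespace Literature.MathematicalPhysics.QuantumFieldTheory.Balaban1983to89.B7Prop3GeneralTildRec

open B7Prop1Explicit hiding Site
open B7Prop1Explicit renaming Site → SiteZ
open MatrixLog B7AvgGaugeCovariance B7Prop3GeneralRotated
open B7Prop3Flat (expCfg)
open B7Prop3GeneralTild (tsum_add tsum_smul)
open B7Eq92Concrete (Rc Rc_apply Rc_mul Rc_inv_apply Rc_one_apply mgauge mgauge_apply mgauge_mul tHol tHol_nil tHol_mgauge mlog_Rc expUnit_conj tHol_one_left)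
open B7Eq78Linearization (conjR conjR_apply conjR_add conjR_smul conjR_one hasDerivAt_mlog_comp hasDerivAt_exp_comp_zero hasDerivAt_conjR_comp)
open B12AverageCorridor267 (Dmlog Dexp hasFDerivAt_mlog hasFDerivAt_exp_Dexp PhiY PhiY_apply)
open BlockAveragingZd (offZ IdxZ WZ WZ_def XZ bavgZ bavgZ_apply avgIterZ)
open B7SectCDGaugeAveragesRec (FcovZ wframeZ tildZ dbavgCovZ)
open B7SectEFLinearisationRec (FhatCovZ Q0covZ QcovZ linQcovZ CcovZ AloopZ DXavgZ QprimeCovZ)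
open B7Eq92ConcreteRec (tildZ_apply dbavgCovZ_apply)
open B7Prop3GeneralLinearRec (hasDerivAt_FcovZ_expCfg FcovZ_expCfg_zero_smul hasDerivAt_wframeZ_expCfg hasDerivAt_wframeZ_inv_expCfg tildZ_one_right wframeZ_one_right
  hasDerivAt_QcovZ_of_tild linQcovZ_eq_of_tild)

variable {d : ℕ}

variable {𝔸 : Type*} [NormedRing 𝔸] [NormedAlgebra ℂ 𝔸] [NormOneClass 𝔸] [CompleteSpace 𝔸]
variable (L : ℕ)

/-! ## §2 The (0.4) loops `W_i = V(Γ ∪ [x,x′] ∪ (−Γ′) ∪ (−c))` along the ray `V₁ = e^{tA}`: (114)–(117) to first order -/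

section Loops

omit [NormOneClass 𝔸] in
/-- the loop holonomy `W_x = V(Γ_{c,x}∪(−c))` of `V = e^{tA}V₀` has `t`-derivative `A_x^{(1)}·W_x(V₀)` at `0`,
`A_x^{(1)} = (R_{0,c₋}A)(Γ_{c,x}∪(−c))` ((114) linearised; `B7Prop3GeneralRotated.hasDerivAt_hol_expCfg_mul`).
[cite: Balaban1985Averaging, (113)–(115) p.34] -/
theorem hasDerivAt_WZ_expCfg (V₀ : SiteZ d → Fin d → 𝔸ˣ) (A : SiteZ d → Fin d → 𝔸) (q : SiteZ d) (κ : Fin d)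
    (i : IdxZ d L) :
    HasDerivAt (fun t : ℂ => ((WZ L (expCfg (t • A) * V₀) q κ i : 𝔸ˣ) : 𝔸))
      (AloopZ L V₀ A q κ i * ((WZ L V₀ q κ i : 𝔸ˣ) : 𝔸)) 0 := by
  simp only [WZ_def]
  exact hasDerivAt_hol_expCfg_mul V₀ A q _

omit [NormOneClass 𝔸] in
/-- **(116) to first order**: "(1/i) log e^{iA_x}e^{iY_x} = Y_x + g⁻¹(−i ad_{Y_x})A_x + O(|A_x|²)" — the `t`-derivative at
`0` of `log W_x(e^{tA}V₀)` is `(D log)_{W_x(V₀)}(A_x^{(1)}·W_x(V₀))` (the Fréchet derivative of the series (21) at the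
background loop, `B12AverageCorridor267.Dmlog`/`hasFDerivAt_mlog` BY NAME; this operator is print's `g⁻¹(−i ad_{Y_x})`
up to the `i`'s), under the small-field condition `‖W_x(V₀) − 1‖ < 1` (from (109) by Prop. 1). [cite: Balaban1985Averaging, (116) p.35, (38) p.22] -/
theorem hasDerivAt_mlog_WZ_expCfg (V₀ : SiteZ d → Fin d → 𝔸ˣ) (A : SiteZ d → Fin d → 𝔸) (q : SiteZ d) (κ : Fin d)
    (i : IdxZ d L) (hW : ‖((WZ L V₀ q κ i : 𝔸ˣ) : 𝔸) - 1‖ < 1) :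
    HasDerivAt (fun t : ℂ => mlog ((WZ L (expCfg (t • A) * V₀) q κ i : 𝔸ˣ) : 𝔸))
      (Dmlog ((WZ L V₀ q κ i : 𝔸ˣ) : 𝔸) (AloopZ L V₀ A q κ i * ((WZ L V₀ q κ i : 𝔸ˣ) : 𝔸))) 0 :=
  (hasFDerivAt_mlog hW).comp_hasDerivAt_of_eq 0 (hasDerivAt_WZ_expCfg L V₀ A q κ i)
    (by rw [expCfg_zero_smul_mul])

omit [NormOneClass 𝔸] in
/-- the exponent `X_c` of (42) for `e^{tA}V₀` has `t`-derivative `DXavg` at `0`, under `‖W_x(V₀) − 1‖ < 1` on the block.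
[cite: Balaban1985Averaging, (117) p.35, (42) p.23] -/
theorem hasDerivAt_XZ_expCfg (V₀ : SiteZ d → Fin d → 𝔸ˣ) (A : SiteZ d → Fin d → 𝔸) (q : SiteZ d) (κ : Fin d)
    (hW : ∀ i : IdxZ d L, ‖((WZ L V₀ q κ i : 𝔸ˣ) : 𝔸) - 1‖ < 1) :
    HasDerivAt (fun t : ℂ => XZ L (expCfg (t • A) * V₀) q κ) (DXavgZ L V₀ A q κ) 0 := by
  unfold XZ DXavgZ
  refine HasDerivAt.fun_sum fun i _ => ?_
  exact (hasDerivAt_mlog_WZ_expCfg L V₀ A q κ i (hW i)).const_smul ((Fintype.card (IdxZ d L) : ℝ))⁻¹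

end Loops

/-! ## §3 The derivative of `Ṽ₁(c)` — (113), (117)–(119): print's `(Q′(V₀)A)_c` for the record -/

section Tild

omit [NormOneClass 𝔸] in
/-- **(113) as a formula for `Ṽ₁(c)` along the ray**: `Ṽ₁(c)[e^{tA}V₀] = exp(X_c(e^{tA}V₀)) · (R_{0,c₋}e^{tA})(c) · exp(−X_c(V₀))`
("(Ṽ₁)_c = exp[i Σ L^{−d}(1/i) log(V₁V₀)(Γ_{c,x}∪(−c))]·(V₁V₀)(c)V₀(c)⁻¹·exp[−i Σ L^{−d}(1/i) log V₀(Γ_{c,x}∪(−c))]").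
[cite: Balaban1985Averaging, (113) p.34] -/
theorem val_tildZ_expCfg (V₀ : SiteZ d → Fin d → 𝔸ˣ) (A : SiteZ d → Fin d → 𝔸) (q : SiteZ d) (κ : Fin d) (t : ℂ) :
    ((tildZ L V₀ (expCfg (t • A)) q κ : 𝔸ˣ) : 𝔸)
      = exp (XZ L (expCfg (t • A) * V₀) q κ) * ((tHol V₀ (expCfg (t • A)) q (seg κ L) : 𝔸ˣ) : 𝔸)
        * exp (-XZ L V₀ q κ) := by
  rw [tildZ_apply, tHol, Units.val_mul, Units.val_mul, bavgZ_apply, Units.val_mul, val_expUnit]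
  have hinv : (((bavgZ L V₀ q κ)⁻¹ : 𝔸ˣ) : 𝔸)
      = (((hol V₀ q (seg κ L))⁻¹ : 𝔸ˣ) : 𝔸) * exp (-XZ L V₀ q κ) := by
    rw [show bavgZ L V₀ q κ = expUnit (XZ L V₀ q κ) * hol V₀ q (seg κ L) from rfl, mul_inv_rev, Units.val_mul,
      val_inv_expUnit, val_expUnit]
  rw [hinv]
  simp only [mul_assoc]

/-- **THE DERIVATIVE OF `Ṽ₁(c)`** along `V₁ = e^{tA}` at `t = 0` is `(Q′(V₀)A)_c` in the form `QprimeCov` — (113)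
differentiated: `(D exp)_{X₀}(ΣL^{−d}(D log)_{W_x}(A_x^{(1)}W_x))·e^{−X₀} + e^{X₀}(R_{0,c₋}A)(c)e^{−X₀}` (the middle factor
`(R_{0,c₋}e^{tA})(c)` passes through `1` with derivative `(R_{0,c₋}A)(c)`), under `‖W_x(V₀) − 1‖ < 1` on `B(c₋)`.
[cite: Balaban1985Averaging, (117)–(119) p.35, (113) p.34] -/
theorem hasDerivAt_tildZ_expCfg (V₀ : SiteZ d → Fin d → 𝔸ˣ) (A : SiteZ d → Fin d → 𝔸) (q : SiteZ d) (κ : Fin d)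
    (hW : ∀ i : IdxZ d L, ‖((WZ L V₀ q κ i : 𝔸ˣ) : 𝔸) - 1‖ < 1) :
    HasDerivAt (fun t : ℂ => ((tildZ L V₀ (expCfg (t • A)) q κ : 𝔸ˣ) : 𝔸)) (QprimeCovZ L V₀ A q κ) 0 := by
  have hX := hasDerivAt_XZ_expCfg L V₀ A q κ hW
  have h1 : HasDerivAt (fun t : ℂ => exp (XZ L (expCfg (t • A) * V₀) q κ))
      (Dexp (XZ L V₀ q κ) (DXavgZ L V₀ A q κ)) 0 :=
    (hasFDerivAt_exp_Dexp (XZ L V₀ q κ)).comp_hasDerivAt_of_eq 0 hX (by rw [expCfg_zero_smul_mul])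
  have h2 := hasDerivAt_tHol_expCfg V₀ A q (seg κ L)
  have h := (h1.fun_mul h2).mul_const (exp (-XZ L V₀ q κ))
  simp only [expCfg_zero_smul_mul, tHol_expCfg_zero_smul, Units.val_one, mul_one] at h
  simp_rw [val_tildZ_expCfg]
  refine h.congr_deriv ?_
  rw [QprimeCovZ, PhiY_apply, conjR_apply, val_inv_expUnit, val_expUnit, val_expUnit, add_mul]

end Tild

/-! ## §4 (120): the linear part «L(Q(V₀)A)_c» in closed form, and its linearity -/

section Assembly

/-- **(120) DIFFERENTIATED — THE LINEAR PART IN CLOSED FORM**: under `‖W_x(V₀) − 1‖ < 1` on `B(c₋)`, `t ↦ Q(V₀, tA, c)` has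
`t`-derivative `−F̂_{V₀}(c₋) + (Q′(V₀)A)_c + R̄_{0,c}F̂_{V₀}(c₊)` at `0` — the three first-order terms of the exponent of
(120) "−i Σ_{x∈B(c₋)} L^{−d}(R_{0,c₋}A)(Γ_{c₋,x}) + i(Q′(V₀)A)_c + i Σ_{x′∈B(c₊)} L^{−d} R̄_{0,c}(R_{0,c₊}A)(Γ_{c₊,x′})"
(`B7Prop3GeneralLinear.hasDerivAt_QcovZ_of_tild` with `D := QprimeCov` from §3). [cite: Balaban1985Averaging, (120) p.35, (122) p.36] -/
theorem hasDerivAt_QcovZ (V₀ : SiteZ d → Fin d → 𝔸ˣ) (A : SiteZ d → Fin d → 𝔸) (q : SiteZ d) (κ : Fin d)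
    (hW : ∀ i : IdxZ d L, ‖((WZ L V₀ q κ i : 𝔸ˣ) : 𝔸) - 1‖ < 1) :
    HasDerivAt (fun t : ℂ => QcovZ L V₀ (t • A) q κ)
      (-FhatCovZ L V₀ A q + QprimeCovZ L V₀ A q κ + conjR (bavgZ L V₀ q κ) (FhatCovZ L V₀ A (q + (L : ℤ) • e κ))) 0 :=
  hasDerivAt_QcovZ_of_tild L V₀ A q κ (hasDerivAt_tildZ_expCfg L V₀ A q κ hW)

/-- **«L(Q(V₀)A)_c» IN CLOSED FORM** ((120) ⇒ (122)): `linQcov = −F̂_{V₀}(c₋) + (Q′(V₀)A)_c + R̄_{0,c}F̂_{V₀}(c₊)`, under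
`‖W_x(V₀) − 1‖ < 1` on `B(c₋)`. The regrouping into (124) (main term (125) + four `[operator − 1]`-remainders) and the
bound (126) are the sequel's. [cite: Balaban1985Averaging, (120) p.35, (122) p.36, (124) p.36] -/
theorem linQcovZ_eq (V₀ : SiteZ d → Fin d → 𝔸ˣ) (A : SiteZ d → Fin d → 𝔸) (q : SiteZ d) (κ : Fin d)
    (hW : ∀ i : IdxZ d L, ‖((WZ L V₀ q κ i : 𝔸ˣ) : 𝔸) - 1‖ < 1) :
    linQcovZ L V₀ A q κ
      = -FhatCovZ L V₀ A q + QprimeCovZ L V₀ A q κ + conjR (bavgZ L V₀ q κ) (FhatCovZ L V₀ A (q + (L : ℤ) • e κ)) :=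
  (hasDerivAt_QcovZ L V₀ A q κ hW).deriv

omit [NormedAlgebra ℂ 𝔸] [NormOneClass 𝔸] [CompleteSpace 𝔸] in
/-- `F̂_{V₀}` is additive in `A`. [cite: Balaban1985Averaging, (112) p.34, (122) p.36] -/
theorem FhatCovZ_add [NormedAlgebra ℂ 𝔸] (V₀ : SiteZ d → Fin d → 𝔸ˣ) (A A' : SiteZ d → Fin d → 𝔸) (y : SiteZ d) :
    FhatCovZ L V₀ (A + A') y = FhatCovZ L V₀ A y + FhatCovZ L V₀ A' y := by
  simp [FhatCovZ, tsum_add, smul_add, Finset.sum_add_distrib]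

omit [NormOneClass 𝔸] [CompleteSpace 𝔸] in
/-- `F̂_{V₀}` is `ℂ`-homogeneous in `A`. [cite: Balaban1985Averaging, (112) p.34, (122) p.36] -/
theorem FhatCovZ_smul (V₀ : SiteZ d → Fin d → 𝔸ˣ) (c : ℂ) (A : SiteZ d → Fin d → 𝔸) (y : SiteZ d) :
    FhatCovZ L V₀ (c • A) y = c • FhatCovZ L V₀ A y := by
  simp [FhatCovZ, tsum_smul, Finset.smul_sum, smul_comm c]

omit [NormOneClass 𝔸] in
/-- `(Q′(V₀)·)_c` is additive in `A` (every operator in (119) is linear). [cite: Balaban1985Averaging, (119) p.35, (122) p.36] -/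
theorem QprimeCovZ_add (V₀ : SiteZ d → Fin d → 𝔸ˣ) (A A' : SiteZ d → Fin d → 𝔸) (q : SiteZ d) (κ : Fin d) :
    QprimeCovZ L V₀ (A + A') q κ = QprimeCovZ L V₀ A q κ + QprimeCovZ L V₀ A' q κ := by
  simp only [QprimeCovZ, DXavgZ, AloopZ, tsum_add, add_mul, map_add, smul_add, Finset.sum_add_distrib, conjR_add]
  abel

omit [NormOneClass 𝔸] [CompleteSpace 𝔸] in
/-- `DXavg` is `ℂ`-homogeneous in `A`. [cite: Balaban1985Averaging, (117) p.35, (122) p.36] -/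
theorem DXavgZ_smul (V₀ : SiteZ d → Fin d → 𝔸ˣ) (c : ℂ) (A : SiteZ d → Fin d → 𝔸) (q : SiteZ d) (κ : Fin d) :
    DXavgZ L V₀ (c • A) q κ = c • DXavgZ L V₀ A q κ := by
  simp only [DXavgZ, AloopZ, tsum_smul, smul_mul_assoc, map_smul, Finset.smul_sum]
  exact Finset.sum_congr rfl fun r _ => smul_comm _ _ _

omit [NormOneClass 𝔸] in
/-- `(Q′(V₀)·)_c` is `ℂ`-homogeneous in `A`. [cite: Balaban1985Averaging, (119) p.35, (122) p.36] -/
theorem QprimeCovZ_smul (V₀ : SiteZ d → Fin d → 𝔸ˣ) (c : ℂ) (A : SiteZ d → Fin d → 𝔸) (q : SiteZ d) (κ : Fin d) :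
    QprimeCovZ L V₀ (c • A) q κ = c • QprimeCovZ L V₀ A q κ := by
  rw [QprimeCovZ, QprimeCovZ, DXavgZ_smul, map_smul, tsum_smul, conjR_smul, smul_add]

/-- **"its Taylor expansion begins with a first-order polynomial" — THE LINEAR PART IS ADDITIVE IN `A`** (a genuine
content of (122), now a theorem for the derivative-defined «L(Q(V₀)A)_c»), under `‖W_x(V₀) − 1‖ < 1` on `B(c₋)`.
[cite: Balaban1985Averaging, (122) p.36] -/
theorem linQcovZ_add (V₀ : SiteZ d → Fin d → 𝔸ˣ) (A A' : SiteZ d → Fin d → 𝔸) (q : SiteZ d) (κ : Fin d)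
    (hW : ∀ i : IdxZ d L, ‖((WZ L V₀ q κ i : 𝔸ˣ) : 𝔸) - 1‖ < 1) :
    linQcovZ L V₀ (A + A') q κ = linQcovZ L V₀ A q κ + linQcovZ L V₀ A' q κ := by
  rw [linQcovZ_eq L V₀ _ q κ hW, linQcovZ_eq L V₀ A q κ hW, linQcovZ_eq L V₀ A' q κ hW, FhatCovZ_add, FhatCovZ_add,
    QprimeCovZ_add, conjR_add, neg_add]
  abel

/-- … and `ℂ`-HOMOGENEOUS in `A`. [cite: Balaban1985Averaging, (122) p.36] -/
theorem linQcovZ_smul (V₀ : SiteZ d → Fin d → 𝔸ˣ) (c : ℂ) (A : SiteZ d → Fin d → 𝔸) (q : SiteZ d) (κ : Fin d)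
    (hW : ∀ i : IdxZ d L, ‖((WZ L V₀ q κ i : 𝔸ˣ) : 𝔸) - 1‖ < 1) :
    linQcovZ L V₀ (c • A) q κ = c • linQcovZ L V₀ A q κ := by
  rw [linQcovZ_eq L V₀ _ q κ hW, linQcovZ_eq L V₀ A q κ hW, FhatCovZ_smul, FhatCovZ_smul, QprimeCovZ_smul, conjR_smul,
    smul_add, smul_add, smul_neg]

end Assembly

end Literature.MathematicalPhysics.QuantumFieldTheory.Balaban1983to89.B7Prop3GeneralTildRec
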